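import Mathlib
import Summits.Ventures.PercRepro2.RBDefs
import Summits.Ventures.PercRepro2.RBRoot
import Summits.Ventures.PercRepro2.RBRootDefs
import Summits.Ventures.PercRepro2.RBRootEdge
import Summits.Ventures.PercRepro2.RBRootEdgePin
import Summits.Ventures.PercRepro2.RBRootEdgeMain
import Summits.Ventures.PercRepro2.RBRootEdgeT
import Summits.Ventures.PercRepro2.RBRootIsolated
import Summits.Ventures.PercRepro2.RBTwoMarkers
import Summits.Ventures.PercRepro2.RBTwoMarkersMain
import Summits.Ventures.PercRepro2.RBTwoMarkersCross
import Summits.Ventures.PercRepro2.RBTwoMarkersCrossMain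
import Summits.Ventures.PercRepro2.RBKernel
import Summits.Ventures.PercRepro2.RBParallel

/-!
# The kernel theorem as the typed row 2′RB (mine-a g5; MINE-A.md §33)

`RBKernel.rb_of_skeleton` restated with `RB.RBcross` / `RB.RBsame` of RBDefs.lean: for every
third vertex `w ∉ {s, t, b, o}` whose edges of nonzero weight end in `{s, t, b, o}`, with at most
one such edge to `b` and at most one to `o`, `RB.RBcross p ends o b s t w ∧ RB.RBsame p ends o b s t w`.
Together with `RB.RBcross_and_RBsame_of_mem` (`w ∈ {s, t, b, o}`) this is the typed row at every
vertex `w` with `N⁺(w) ⊆ {s, t, b, o}` (`N⁺` = neighbours through edges of nonzero weight), and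
with the parallel-edge merge of `RBParallel` the multiplicity condition disappears
(`RBcross_and_RBsame_of_nbhd'`: every vertex `w` with `N⁺(w) ⊆ {s, t, b, o}`, full stop).
-/

namespace Summit.Ventures.PercRepro2

namespace RB

open scoped Classical

variable {V : Type*} {E : Type*} [Fintype E] [DecidableEq E] [Fintype V] [DecidableEq V]
  {R : Type*} [Field R] [LinearOrder R] [IsStrictOrderedRing R]

omit [DecidableEq V] in
/-- **The typed row at every third vertex whose nonzero-weight edges end in `{s, t, b, o}`**
(at most one such edge to each marker): `RBKernel.rb_of_skeleton`. -/
theorem RBcross_and_RBsame_of_skeleton {p : E → R} (hp : IsProbVec p) (ends : E → Sym2 V)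
    (o b s t w : V)
    (H : ∀ e, w ∈ ends e → p e ≠ 0 →
      ends e = s(w, s) ∨ ends e = s(w, t) ∨ ends e = s(w, b) ∨ ends e = s(w, o))
    (Hb : ∀ e e', ends e = s(w, b) → ends e' = s(w, b) → p e ≠ 0 → p e' ≠ 0 → e = e')
    (Ho : ∀ e e', ends e = s(w, o) → ends e' = s(w, o) → p e ≠ 0 → p e' ≠ 0 → e = e')
    (hws : s ≠ w) (hwt : t ≠ w) (hwb : b ≠ w) (hwo : o ≠ w) :
    RBcross p ends o b s t w ∧ RBsame p ends o b s t w := by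
  unfold RBcross RBsame
  rw [rbSum_eq_rbRoot, rbSum_eq_rbRoot]
  exact RBKernel.rb_of_skeleton ends s t w hp o b H Hb Ho hws hwt hwb hwo

omit [DecidableEq V] in
/-- **The typed row at every vertex `w` with `N⁺(w) ⊆ {s, t, b, o}`**: `w` a root or a marker
(`RBcross_and_RBsame_of_mem`), or a third vertex of the kernel class. -/
theorem RBcross_and_RBsame_of_nbhd {p : E → R} (hp : IsProbVec p) (ends : E → Sym2 V)
    (o b s t w : V)
    (H : ∀ e, w ∈ ends e → p e ≠ 0 →
      ends e = s(w, s) ∨ ends e = s(w, t) ∨ ends e = s(w, b) ∨ ends e = s(w, o))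
    (Hb : ∀ e e', ends e = s(w, b) → ends e' = s(w, b) → p e ≠ 0 → p e' ≠ 0 → e = e')
    (Ho : ∀ e e', ends e = s(w, o) → ends e' = s(w, o) → p e ≠ 0 → p e' ≠ 0 → e = e') :
    RBcross p ends o b s t w ∧ RBsame p ends o b s t w := by
  by_cases hw : w = s ∨ w = t ∨ w = b ∨ w = o
  · exact RBcross_and_RBsame_of_mem hp ends o b s t w hw
  · exact RBcross_and_RBsame_of_skeleton hp ends o b s t w H Hb Ho (fun h => hw (Or.inl h.symm))
      (fun h => hw (Or.inr (Or.inl h.symm))) (fun h => hw (Or.inr (Or.inr (Or.inl h.symm))))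
      (fun h => hw (Or.inr (Or.inr (Or.inr h.symm))))

omit [DecidableEq V] in
/-- **The typed row at every vertex `w` with `N⁺(w) ⊆ {s, t, b, o}` — no multiplicity
condition**: parallel marker edges are merged one pair at a time (`RBParallel`, induction on the
number of marker edges of nonzero weight), then `RBcross_and_RBsame_of_nbhd`. -/
theorem RBcross_and_RBsame_of_nbhd' {p : E → R} (hp : IsProbVec p) (ends : E → Sym2 V)
    (o b s t w : V)
    (H : ∀ e, w ∈ ends e → p e ≠ 0 →
      ends e = s(w, s) ∨ ends e = s(w, t) ∨ ends e = s(w, b) ∨ ends e = s(w, o)) :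
    RBcross p ends o b s t w ∧ RBsame p ends o b s t w := by
  suffices key : ∀ n : ℕ, ∀ p : E → R, IsProbVec p →
      (∀ e, w ∈ ends e → p e ≠ 0 →
        ends e = s(w, s) ∨ ends e = s(w, t) ∨ ends e = s(w, b) ∨ ends e = s(w, o)) →
      (Finset.univ.filter (fun e => (ends e = s(w, b) ∨ ends e = s(w, o)) ∧ p e ≠ 0)).card ≤ n →
      RBcross p ends o b s t w ∧ RBsame p ends o b s t w from
    key _ p hp H le_rfl
  intro n
  induction n with
  | zero =>
    intro p hp H hcard
    have hno : ∀ e, (ends e = s(w, b) ∨ ends e = s(w, o)) → p e ≠ 0 → False := by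
      intro e he hpe
      have hmem : e ∈ Finset.univ.filter (fun e => (ends e = s(w, b) ∨ ends e = s(w, o)) ∧ p e ≠ 0) :=
        Finset.mem_filter.2 ⟨Finset.mem_univ e, he, hpe⟩
      have := Finset.card_pos.2 ⟨e, hmem⟩
      omega
    exact RBcross_and_RBsame_of_nbhd hp ends o b s t w H
      (fun e _ he _ hpe _ => absurd hpe (hno e (Or.inl he)))
      (fun e _ he _ hpe _ => absurd hpe (hno e (Or.inr he)))
  | succ n ih =>
    intro p hp H hcard
    by_cases hsimple : (∀ e e', ends e = s(w, b) → ends e' = s(w, b) → p e ≠ 0 → p e' ≠ 0 → e = e') ∧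
        (∀ e e', ends e = s(w, o) → ends e' = s(w, o) → p e ≠ 0 → p e' ≠ 0 → e = e')
    · exact RBcross_and_RBsame_of_nbhd hp ends o b s t w H hsimple.1 hsimple.2
    -- a parallel pair of marker edges of nonzero weight: merge it
    have hpair : ∃ e e', e ≠ e' ∧ ends e = ends e' ∧ (ends e = s(w, b) ∨ ends e = s(w, o)) ∧
        p e ≠ 0 ∧ p e' ≠ 0 := by
      rcases not_and_or.1 hsimple with hb | ho
      · simp only [not_forall] at hb
        obtain ⟨e, e', he, he', hpe, hpe', hne⟩ := hb
        exact ⟨e, e', hne, he.trans he'.symm, Or.inl he, hpe, hpe'⟩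
      · simp only [not_forall] at ho
        obtain ⟨e, e', he, he', hpe, hpe', hne⟩ := ho
        exact ⟨e, e', hne, he.trans he'.symm, Or.inr he, hpe, hpe'⟩
    obtain ⟨e, e', hne, hpar, hmk, hpe, hpe'⟩ := hpair
    set p' : E → R := Function.update (Function.update p e (p e + p e' - p e * p e')) e' 0 with hp'
    have hp'v : IsProbVec p' := RBParallel.isProbVec_merge hp e e'
    have H' : ∀ f, w ∈ ends f → p' f ≠ 0 →
        ends f = s(w, s) ∨ ends f = s(w, t) ∨ ends f = s(w, b) ∨ ends f = s(w, o) := by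
      intro f hf hpf
      by_cases hfe' : f = e'
      · subst hfe'
        exact absurd (Function.update_self _ _ _) hpf
      · by_cases hfe : f = e
        · subst hfe
          rcases hmk with h | h
          · exact Or.inr (Or.inr (Or.inl h))
          · exact Or.inr (Or.inr (Or.inr h))
        · rw [hp', Function.update_of_ne hfe', Function.update_of_ne hfe] at hpf
          exact H f hf hpf
    have hcard' :
        (Finset.univ.filter (fun f => (ends f = s(w, b) ∨ ends f = s(w, o)) ∧ p' f ≠ 0)).card ≤ n := by
      set F := Finset.univ.filter (fun f => (ends f = s(w, b) ∨ ends f = s(w, o)) ∧ p f ≠ 0) with hF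
      have hsub : Finset.univ.filter (fun f => (ends f = s(w, b) ∨ ends f = s(w, o)) ∧ p' f ≠ 0) ⊆
          F.erase e' := by
        intro f hf
        rw [Finset.mem_filter] at hf
        rw [Finset.mem_erase, hF, Finset.mem_filter]
        have hfe' : f ≠ e' := by
          rintro rfl
          exact hf.2.2 (Function.update_self _ _ _)
        refine ⟨hfe', Finset.mem_univ f, hf.2.1, ?_⟩
        by_cases hfe : f = e
        · subst hfe; exact hpe
        · have := hf.2.2
          rwa [hp', Function.update_of_ne hfe', Function.update_of_ne hfe] at this
      have hmem : e' ∈ F := Finset.mem_filter.2 ⟨Finset.mem_univ e', by rw [← hpar]; exact hmk, hpe'⟩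
      have h1 := Finset.card_le_card hsub
      rw [Finset.card_erase_of_mem hmem] at h1
      omega
    have key := ih p' hp'v H' hcard'
    -- transfer back along the merge
    have goal' : (RBRoot.rbSum p ends s t w (connEvent ends b s) (connEvent ends o t) ≤
        prob p ((connEvent ends s t)ᶜ ∩ connEvent ends b s) *
          prob p ((connEvent ends s t)ᶜ ∩ connEvent ends o t) / prob p (connEvent ends s t)ᶜ) ∧
        (prob p ((connEvent ends s t)ᶜ ∩ connEvent ends b s) *
          prob p ((connEvent ends s t)ᶜ ∩ connEvent ends o s) / prob p (connEvent ends s t)ᶜ ≤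
        RBRoot.rbSum p ends s t w (connEvent ends b s) (connEvent ends o s)) := by
      obtain ⟨m1, m2⟩ := RBParallel.prob_merge_parallel_conn ends s t p hne hpar b s
      obtain ⟨m3, -⟩ := RBParallel.prob_merge_parallel_conn ends s t p hne hpar o t
      obtain ⟨m4, -⟩ := RBParallel.prob_merge_parallel_conn ends s t p hne hpar o s
      rw [RBParallel.rbSum_merge_parallel ends s t w p hne hpar b s o t,
        RBParallel.rbSum_merge_parallel ends s t w p hne hpar b s o s, m1, m2, m3, m4]
      exact key
    exact goal'

end RB

end Summit.Ventures.PercRepro2
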